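import Mathlib
import Summits.KontsevichZagierPeriods.Zeta5Search.Certificates.RayC1Thm1OfN
import Summits.KontsevichZagierPeriods.Zeta5Search.Certificates.RayC1AperyPQ
import Summits.KontsevichZagierPeriods.Zeta5Search.Certificates.RayC1Window
import Summits.KontsevichZagierPeriods.Zeta5Search.Certificates.RayC1KernelClassR9
import HarnessLib

/-!
# ONE theorem of the printed Theorem-1 SHAPE on the calibration ray C1, in the `∃ᶠ` form, at the R9 literal `4347/5000`
(cert-1 g8, S4-C1 LITE — the ONE named C1 theorem asked for by the lead 2026-08-22T13:22Z; assembly only, no new certificate)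

HONEST FRAMING: systematic search; no irrationality claim unless certified.  C1 is the CALIBRATION ray
`a = (18,32,23,30,28,38,43,30)` of the cell's search; `(P_n, Q_n) = (c1P n, c1Q n)` is the explicit pair built from
Brown–Zudilin's cellular integral on that ray (`RayC1Forms`).  This file assembles, BY NAME, tree theorems only:

* (E)  `aperyType_c1PQ : IsAperyType c1P (fun n => (c1Q n : ℚ))` (`RayC1AperyPQ`, cert-1 g7): ONE order-3 recurrence over `ℚ[n]`
  with nonzero top coefficient annihilates both `c1P` and `c1Q`;
* LIMIT  `tendsto_c1P_div_c1Q` (`RayC1Thm1OfN`, fam-tele g17 / P2 g8): `P_n/Q_n → ζ(5)`, unconditional;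
* (N ∃ᶠ)  `c1Form_frequently_ne_zero` (`RayC1Window`, fam-tele g22 / P2 g8): `Q_n ζ(5) − P_n ≠ 0` for infinitely many `n`
  (the ZMod-193 window); the all-`n` statement (N ∀ᶠ) is NOT in the tree for C1 (that is the FULL package, not opened);
* (M)  `RayC1.c1_exponent_classR9` (typer g18, p326503): for every `0 ≤ γ ≤ 4347/5000 = 0.8694`, eventually
  `|ζ(5) − P_n/Q_n| < 1/q_n^γ` with the integers `p_n = kMPR9 n·P_n`, `q_n = kMPR9 n·|Q_n| ≥ 1`.

WHY R9 AND NOT R8: `c1_exponent_classR9` has literally the shape of `c1_exponent_classR8` with the multiplier `kMPR9` in place of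
`kMPR8`, so it composes through the SAME reduced-denominator transport as L6′/L7 (`den(P_n/Q_n) ≤ q_n` because `P_n/Q_n = ±p_n/q_n`);
the transport is restated here once for an arbitrary multiplier (`den_div_le_of_scaled`) instead of importing L7's `kMPR8`-specific
`den_c1P_div_le`.  ONE literal: `4347/5000` (R9).  (R10 is not in the tree at the time of writing; if it lands, the same three lines
give the R10 literal — stager's call, not done here.)

WHAT THIS IS NOT: it is NOT `BrownZudilin2022.theorem1'` — that typed statement is `∀ᶠ` in `n` and is witnessed in the tree by
Brown–Zudilin's OWN record pair (`RecordRay.Generic.theorem1'_holds`, #12); here the non-vanishing/metric clause is `∃ᶠ` ("for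
infinitely many `n`" = the printed "infinite sequence" shape) and the pair is the cell's C1 pair.  The exponent `0.8694 < 1`: NO
irrationality content, no number in print moves, C1 stays a calibration ray.  Whether this statement bears on [BZ22] p. 27's
comparison sentence is the referees' read, not this file's.
-/

namespace Summit.KontsevichZagierPeriods.Zeta5Search.RayC1.Generic

open Filter Topology
open Literature.NumberTheory.Transcendental (zetaValue)
open Literature.NumberTheory.Irrationality.BrownZudilin2022 (IsAperyType)

/-- Reduced-denominator transport for an ARBITRARY multiplier `k`: if `p = k·P` is an integer and `q = k·|Q| ≥ 1` is a natural
number (`Q ≠ 0`), then `P/Q = ±p/q`, so the reduced denominator of `P/Q` divides `q`; in particular `den(P/Q) ≤ q`.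
(L7's `den_c1P_div_le` is the instance `k = kMPR8 n`; this generic form serves `kMPR9` and any later round.) -/
theorem den_div_le_of_scaled {P Q k : ℚ} {p : ℤ} {q : ℕ} (hQ : Q ≠ 0) (hq : 1 ≤ q)
    (hqQ : (q : ℚ) = k * |Q|) (hpP : (p : ℚ) = k * P) : (P / Q).den ≤ q := by
  have hq0 : (q : ℚ) ≠ 0 := by exact_mod_cast (by omega : q ≠ 0)
  obtain ⟨Z, hZ⟩ : ∃ Z : ℤ, P / Q = (Z : ℚ) / (q : ℚ) := by
    rcases abs_choice Q with habs | habs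
    · exact ⟨p, by rw [div_eq_div_iff hQ hq0, hpP, hqQ, habs]; ring⟩
    · exact ⟨-p, by rw [div_eq_div_iff hQ hq0, Int.cast_neg, hpP, hqQ, habs]; ring⟩
  have hdvd : (P / Q).den ∣ q := by
    rw [hZ]
    have h := Rat.den_dvd Z q
    rw [Rat.divInt_eq_div] at h
    push_cast at h
    exact Int.natCast_dvd_natCast.1 h
  exact Nat.le_of_dvd (by omega) hdvd

/-- **(M) of round R9 on the REDUCED denominator.**  For every `0 ≤ γ ≤ 4347/5000` and all large `n`:
`|ζ(5) − P_n/Q_n| < 1/den(P_n/Q_n)^γ` on C1 — `c1_exponent_classR9` moved from `q_n = kMPR9 n·|Q_n|` to `den(P_n/Q_n) ≤ q_n`.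
HONEST FRAMING: `γ < 1`; a metric inequality for explicit rationals, no irrationality content. -/
theorem c1_metric_den_eventually_R9 {γ : ℝ} (h0 : 0 ≤ γ) (hγ : γ ≤ 4347 / 5000) :
    ∀ᶠ n : ℕ in atTop,
      |zetaValue 5 - ((c1P n / (c1Q n : ℚ) : ℚ) : ℝ)| < 1 / ((c1P n / (c1Q n : ℚ)).den : ℝ) ^ γ := by
  filter_upwards [c1_exponent_classR9 h0 hγ] with n hM
  obtain ⟨p, q, hq, hqQ, hpP, hlt⟩ := hM
  rw [ratCast_c1P_div]
  refine hlt.trans_le ?_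
  have hQQ : ((c1Q n : ℤ) : ℚ) ≠ 0 := by exact_mod_cast c1Q_ne_zero n
  have hden : ((c1P n / (c1Q n : ℚ)).den : ℝ) ≤ q := by
    exact_mod_cast den_div_le_of_scaled hQQ hq hqQ hpP
  have hden0 : (0 : ℝ) < ((c1P n / (c1Q n : ℚ)).den : ℝ) := by exact_mod_cast Rat.den_pos _
  exact one_div_le_one_div_of_le (Real.rpow_pos_of_pos hden0 _) (Real.rpow_le_rpow hden0.le hden h0)

/-- **The `∃ᶠ` clause body on C1, for every `0 ≤ γ ≤ 4347/5000`.**  For infinitely many `n`: `Q_n ≠ 0`,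
`0 < |ζ(5) − P_n/Q_n|` (from (N ∃ᶠ) `c1Form_frequently_ne_zero`, `L_n = Q_nζ(5) − P_n`) and `|ζ(5) − P_n/Q_n| < 1/den(P_n/Q_n)^γ`
(from (M) R9), combined by `Frequently.and_eventually`.  HONEST FRAMING: `γ < 1`; no irrationality content; C1 = calibration ray. -/
theorem c1_shape_clauses_frequently {γ : ℝ} (h0 : 0 ≤ γ) (hγ : γ ≤ 4347 / 5000) :
    ∃ᶠ n : ℕ in atTop, (c1Q n : ℚ) ≠ 0 ∧ 0 < |zetaValue 5 - ((c1P n / (c1Q n : ℚ) : ℚ) : ℝ)| ∧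
      |zetaValue 5 - ((c1P n / (c1Q n : ℚ) : ℚ) : ℝ)| < 1 / ((c1P n / (c1Q n : ℚ)).den : ℝ) ^ γ := by
  refine (c1Form_frequently_ne_zero.and_eventually
    ((eventually_ge_atTop 1).and (c1_metric_den_eventually_R9 h0 hγ))).mono fun n hn => ?_
  obtain ⟨hL, hn1, hM⟩ := hn
  have hQR : (c1Q n : ℝ) ≠ 0 := by exact_mod_cast c1Q_ne_zero n
  refine ⟨by exact_mod_cast c1Q_ne_zero n, ?_, hM⟩
  rw [ratCast_c1P_div, c1P_div_c1Q_eq hn1, sub_sub_cancel, abs_pos]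
  exact div_ne_zero hL hQR

/-- **ONE theorem of the printed Theorem-1 shape on the C1 ray (`∃ᶠ` form), literal exponent `4347/5000 = 0.8694` (R9).**
There is an Apéry-type pair of rationals `(p_n, q_n)` — WITNESSES `p = c1P`, `q n = (c1Q n : ℚ)`, (E) `aperyType_c1PQ` — with
`p_n/q_n → ζ(5)` (`tendsto_c1P_div_c1Q`) such that for INFINITELY MANY `n`: `q_n ≠ 0`, `0 < |ζ(5) − p_n/q_n| < 1/den(p_n/q_n)^{0.8694}`
((N ∃ᶠ) `c1Form_frequently_ne_zero` ⊕ (M) `c1_exponent_classR9` on the reduced denominator).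
HONEST FRAMING: systematic search; no irrationality claim unless certified.  C1 calibration ray; (N) in the `∃ᶠ` form only; NOT
`theorem1'` (which is `∀ᶠ` and about BZ's own pair); exponent `0.8694 < 1`, no irrationality content, no number in print moves;
whether this statement bears on [BZ22] p. 27's comparison sentence is the referees' read, not this file's. -/
theorem c1_theorem1_shape :
    ∃ p q : ℕ → ℚ, IsAperyType p q ∧
      Tendsto (fun n => ((p n / q n : ℚ) : ℝ)) atTop (𝓝 (zetaValue 5)) ∧
      ∃ᶠ n : ℕ in atTop, q n ≠ 0 ∧
        0 < |zetaValue 5 - ((p n / q n : ℚ) : ℝ)| ∧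
          |zetaValue 5 - ((p n / q n : ℚ) : ℝ)| < 1 / ((p n / q n).den : ℝ) ^ (4347 / 5000 : ℝ) :=
  ⟨c1P, fun n => (c1Q n : ℚ), aperyType_c1PQ, tendsto_c1P_div_c1Q,
    c1_shape_clauses_frequently (γ := 4347 / 5000) (by norm_num) le_rfl⟩

end Summit.KontsevichZagierPeriods.Zeta5Search.RayC1.Generic
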